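import Summits.NavierStokesRegularity.NavierStokesRegularity.Theorems.AxisTwistDoorAveragedConeLiouvilleNUEnergyClass
import HarnessLib

/-!
# N4 piece P4b — TOOLS (cut-off products, measurability of functions continuous on an open set and
# zero off it, the smooth monotone time cut-off) for `…NUStanding` (`nu_standing_of_classical`)

Route `AxisTwistDoor`, crux `AveragedConeLiouville` (stmt-NavierStokesRegularity-26889), INPUT N4
(Nazarov–Ural'tseva 2011 §3 = Lei–Ren–Tian 2025 Lemma 2.5), cut of record pub/ns-inputs STATUS
2026-08-28T11:29:42Z, texts `kits/N4-skeleton.lean` (5372b51f971b2f9d): this file lands the text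
`Sig.nu_standing_of_classical` VERBATIM as `nu_standing_of_classical`.

CONSTRUCTION. Given the classical data `(V, b)` on the open cylinder `]0,T[ × B(0,1)` (`V ∈ C²`,
`b ∈ C¹`, `|b| ≤ Λ`, `div b = 0`, `V ≥ 0`, `∂ₜV − ΔV + ⟪b,∇V⟫ ≥ 0`), a level cap `k > 0`, a
switch-on time `t⋆ ∈ ]0,τ[`, a frame top `τ ≤ T` and a frame scale `R` with `2R < 1`:
* `ψ(s) = smoothTransition(2s/t⋆ − 1)` (smooth, monotone, `= 0` for `s ≤ t⋆/2`, `= 1` for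
  `s ≥ t⋆`), `ψ₁(s) = smoothTransition(4s/t⋆ − 1)` (`= 1` for `s ≥ t⋆/2`), `χ` a smooth bump `= 1` on
  `B̄(0,R')`, supported in `B(0,(R'+1)/2)`, `R' = (2R+1)/2`;
* `Φ(t,x) = χ(x) ψ(t+τ) V(t+τ,x)` for `t < 0` (`0` for `t ≥ 0`), `U(t,x) = ψ₁(t+τ) b(t+τ,x)` on
  `{t < 0} × B(0,1)` (`0` elsewhere).
`ψV` is again a classical supersolution with drift `ψ₁ b` (where `ψ > 0` one has `ψ₁ = 1`, and
`ψ'V ≥ 0`); it vanishes for `t + τ ≤ t⋆/2`, so the frame `]-R², 0[ × B(0,2R)` may hang below the data;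
the energy class on the frame is `nuEnergyClass_of_supersolution` (`…NUEnergyClass`, frame ball
`B(0,R')`); the drift class holds with `N = ((Λ³|B₁|)^{4/3})` since `|U| ≤ Λ` and `2R < 1`.

WHAT THIS IS NOT: not a statement about Navier–Stokes; N4 is an INPUT; item 26889 and the summit
stay open. [cite: NazarovUraltseva2011HarnackDivFree, §3 (arXiv:1011.1888 p. 8)]
[cite: LeiRenTian2025, Lemma 2.5 (arXiv:2501.08976 p. 7)]
-/

noncomputable section

-- the summit and its single sub-problem share the name (CONVENTIONS §1)
set_option linter.dupNamespace false

open MeasureTheory Set Function Filter Topology Metric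
open scoped NNReal ENNReal InnerProductSpace RealInnerProductSpace Laplacian
open Literature.Analysis Literature.Analysis.FluidPDE

namespace Summit.NavierStokesRegularity.NavierStokesRegularity.Theorems.AveragedConeLiouville.NUPositivity

/-! ### Small tools -/

/-- A function `Cⁿ` on an open set `W`, multiplied by a `Cⁿ` cut-off whose topological support lies
in `W`, is `Cⁿ` everywhere. [folklore] -/
theorem contDiff_mul_of_contDiffOn_of_tsupport_subset {n : ℕ∞}
    {θ f : EuclideanSpace ℝ (Fin 3) → ℝ} {W : Set (EuclideanSpace ℝ (Fin 3))} (hW : IsOpen W)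
    (hθ : ContDiff ℝ n θ) (hθW : tsupport θ ⊆ W) (hf : ContDiffOn ℝ n f W) :
    ContDiff ℝ n (fun x => θ x * f x) := by
  rw [contDiff_iff_contDiffAt]
  intro x
  by_cases hx : x ∈ W
  · exact hθ.contDiffAt.mul (hf.contDiffAt (hW.mem_nhds hx))
  · have hx' : x ∉ tsupport θ := fun h => hx (hθW h)
    have h0 : (fun y => θ y * f y) =ᶠ[𝓝 x] fun _ => 0 := by
      filter_upwards [(notMem_tsupport_iff_eventuallyEq.mp hx')] with y hy
      simp [hy]
    exact (contDiffAt_const.congr_of_eventuallyEq h0)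

/-- A function continuous on an open set and vanishing off it is Borel measurable. [folklore] -/
theorem measurable_of_continuousOn_of_eq_zero {X : Type*} [TopologicalSpace X] [MeasurableSpace X]
    [OpensMeasurableSpace X] {F : Type*} [NormedAddCommGroup F] [MeasurableSpace F] [BorelSpace F]
    {f : X → F} {A : Set X} (hA : IsOpen A) (hf : ContinuousOn f A) (h0 : ∀ x, x ∉ A → f x = 0) :
    Measurable f := by
  refine measurable_of_isOpen fun O hO => ?_
  have h1 : f ⁻¹' O = (A ∩ f ⁻¹' O) ∪ (Aᶜ ∩ f ⁻¹' O) := by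
    rw [← union_inter_distrib_right, union_compl_self, univ_inter]
  have h2 : IsOpen (A ∩ f ⁻¹' O) := hf.isOpen_inter_preimage hA hO
  by_cases h0O : (0 : F) ∈ O
  · have h3 : Aᶜ ∩ f ⁻¹' O = Aᶜ := by
      refine inter_eq_left.2 fun x hx => ?_
      show f x ∈ O
      rw [h0 x hx]; exact h0O
    rw [h1, h3]
    exact h2.measurableSet.union hA.measurableSet.compl
  · have h3 : Aᶜ ∩ f ⁻¹' O = ∅ := by
      refine eq_empty_of_forall_notMem fun x hx => h0O ?_
      have : f x ∈ O := hx.2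
      rwa [h0 x hx.1] at this
    rw [h1, h3, union_empty]
    exact h2.measurableSet

/-- The smooth monotone time cut-off `ψ_a(s) = smoothTransition(s/a − 1)` (`a > 0`): smooth,
values in `[0,1]`, `= 0` on `]−∞, a]`, `= 1` on `[2a, ∞[`, nonnegative derivative. [folklore] -/
theorem timeCutoff_props {a : ℝ} (ha : 0 < a) :
    ContDiff ℝ 2 (fun s : ℝ => Real.smoothTransition (s / a - 1)) ∧
    (∀ s, 0 ≤ Real.smoothTransition (s / a - 1) ∧ Real.smoothTransition (s / a - 1) ≤ 1) ∧
    (∀ s, s ≤ a → Real.smoothTransition (s / a - 1) = 0) ∧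
    (∀ s, 2 * a ≤ s → Real.smoothTransition (s / a - 1) = 1) ∧
    (∀ s, 0 ≤ deriv (fun s : ℝ => Real.smoothTransition (s / a - 1)) s) := by
  refine ⟨Real.smoothTransition.contDiff.comp ((contDiff_id.div_const a).sub contDiff_const),
    fun s => ⟨Real.smoothTransition.nonneg _, Real.smoothTransition.le_one _⟩,
    fun s hs => Real.smoothTransition.zero_of_nonpos (by rw [sub_nonpos, div_le_one ha]; exact hs),
    fun s hs => Real.smoothTransition.one_of_one_le (by
      rw [le_sub_iff_add_le, le_div_iff₀ ha]; linarith),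
    fun s => ?_⟩
  have hmono : Monotone (fun s : ℝ => Real.smoothTransition (s / a - 1)) := fun s₁ s₂ h =>
    Real.smoothTransition.monotone (by
      rw [sub_le_sub_iff_right]; exact div_le_div_of_nonneg_right h ha.le)
  exact hmono.deriv_nonneg


end Summit.NavierStokesRegularity.NavierStokesRegularity.Theorems.AveragedConeLiouville.NUPositivity

end
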